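import Mathlib
import Summits.NavierStokesRegularity.NavierStokesRegularity.Theorems.ScenarioCensusPeriodicSlabSwirlFlux
import Literature.Analysis.FluidPDE.Wei2016HardyCutoff
import HarnessLib

/-!
# Census row S7 (c): the coefficient of the dyadic cylindrical cut-off and the rotation field
# `J∇φ`, with second-derivative bounds

Support file for the scenario census of `NavierStokesRegularity` (cell `pub/ns-census`, block S,
row S7 = Bang–Gui–Wang–Xie, J. Fluid Mech. 1005 (2025) A6 = arXiv:2205.13259, Thm 1.4 (c)). The
tree's corrector for case (c) is `Ψ = Φ̃ · J∇φ` with `φ = cylCutoff r (2r)` the dyadic cut-off and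
`J = rotGen`; its derivative involves the HESSIAN of the cut-off, which the tree's cut-off files
(`CylindricalCutoff`, `LeiZhang2011Cutoff`: gradient bounds only) do not provide; the bounds on
`Θ'`, `Θ''` (`Θ = Real.smoothTransition`) are the tree's (`SmoothCutoff`, `Wei2016HardyCutoff`). Here:

* `dyCoeff r` — the explicit coefficient `a` with `Dφ(x) v = a(x) ⟪x_h, v⟫`
  (`fderiv_cylCutoff_two_mul`), smooth, axisymmetric, `z`-invariant, with
  `|a| ≤ C/r² · χ` and `‖Da‖ ≤ C/r³ · χ`, `χ = 𝟙{r ≤ ρ < 2r}` (`exists_dyCoeff_bounds`);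
* `corrField r x = a(x) • J x = J ∇φ(x)` — smooth, `z`-invariant, divergence free
  (`divergence_corrField`), with `‖W‖ ≤ 2C/r · χ`, `‖DW‖ ≤ 3C/r² · χ` (`exists_corrField_bounds`).

No summit statement and no census row is proved in this file.

## References

* J. Bang, C. Gui, Y. Wang, C. Xie, arXiv:2205.13259, §5 Step 3 (proof of Thm 1.4 (c)).
  [BangGuiWangXie2025]
* Z. Lei, Q. S. Zhang, arXiv:1011.5066, §2 (2.1) (the radial cut-offs). [LeiZhang2011]
-/

-- the summit and its single problem share the name (D-0017 nested layout)
set_option linter.dupNamespace false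

noncomputable section

open MeasureTheory Set Function Filter InnerProductSpace
open scoped Topology RealInnerProductSpace

namespace Summit.NavierStokesRegularity.NavierStokesRegularity.Theorems.ScenarioCensus.PeriodicSlab

open Literature.Analysis Literature.Analysis.FluidPDE

/-! ### The coefficient of the dyadic cut-off `φ = cylCutoff r (2r)` -/

/-- The argument of the profile in the dyadic cut-off: `c ((2r)² − ‖x_h‖²)`,
`c = ((2r)² − r²)⁻¹`. -/
def dyArg (r : ℝ) (x : EuclideanSpace ℝ (Fin 3)) : ℝ :=
  ((2 * r) ^ 2 - r ^ 2)⁻¹ * ((2 * r) ^ 2 - ‖horizPart x‖ ^ 2)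

/-- **The coefficient of the gradient of the dyadic cut-off**, `∇φ(x) = a(x) x_h`:
`a(x) = Θ'(c((2r)² − ‖x_h‖²)) · (−2c)`. -/
def dyCoeff (r : ℝ) (x : EuclideanSpace ℝ (Fin 3)) : ℝ :=
  deriv Real.smoothTransition (dyArg r x) * (((2 * r) ^ 2 - r ^ 2)⁻¹ * (-2))

/-- `Dφ(x) v = a(x) ⟪x_h, v⟫` for the dyadic cut-off `φ = cylCutoff r (2r)`. -/
theorem fderiv_cylCutoff_two_mul (r : ℝ) (x v : EuclideanSpace ℝ (Fin 3)) :
    fderiv ℝ (cylCutoff r (2 * r)) x v = dyCoeff r x * ⟪horizPart x, v⟫ := by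
  rw [fderiv_cylCutoff, (LeiZhang2011.hasFDerivAt_radialCutoff r (2 * r) (horizPart x)).fderiv]
  simp only [FunLike.coe_smul, Pi.smul_apply, _root_.neg_apply, innerSL_apply_apply, smul_eq_mul,
    dyCoeff, dyArg]
  ring

/-- `a` is smooth. -/
theorem contDiff_dyCoeff (r : ℝ) {n : ℕ∞} : ContDiff ℝ n (dyCoeff r) := by
  refine (Wei2016.contDiff_deriv_smoothTransition.comp ?_).mul contDiff_const
  exact contDiff_const.mul (contDiff_const.sub ((contDiff_norm_sq ℝ).comp horizPart.contDiff))

/-- `a` is invariant under axial translations. -/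
theorem dyCoeff_add_smul_eZ (r : ℝ) (x : EuclideanSpace ℝ (Fin 3)) (t : ℝ) :
    dyCoeff r (x + t • eZ) = dyCoeff r x := by
  simp only [dyCoeff, dyArg, horizPart_add_smul_eZ]

/-- `a` is axisymmetric. -/
theorem isAxisymmetricScalar_dyCoeff (r : ℝ) : IsAxisymmetricScalar (dyCoeff r) := fun θ x => by
  simp only [dyCoeff, dyArg, horizPart_rotZ, norm_rotZ]

/-- The derivative of `a`: `Da(x) v = 4c² Θ''(arg) ⟪x_h, v⟫`. -/
theorem hasFDerivAt_dyCoeff (r : ℝ) (x : EuclideanSpace ℝ (Fin 3)) :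
    HasFDerivAt (dyCoeff r)
      ((deriv (deriv Real.smoothTransition) (dyArg r x) *
          ((((2 * r) ^ 2 - r ^ 2)⁻¹ * (-2)) * (((2 * r) ^ 2 - r ^ 2)⁻¹ * (-2)))) •
        innerSL ℝ (horizPart x)) x := by
  set c : ℝ := ((2 * r) ^ 2 - r ^ 2)⁻¹ with hc
  have h1 : HasFDerivAt (fun y : EuclideanSpace ℝ (Fin 3) => ‖horizPart y‖ ^ 2)
      ((2 : ℝ) • (innerSL ℝ (horizPart x)).comp horizPart) x := by
    have h := ((hasFDerivAt_id (horizPart x)).norm_sq).comp x horizPart.hasFDerivAt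
    refine h.congr_fderiv ?_
    ext v
    simp [ContinuousLinearMap.comp_apply, innerSL_apply_apply]
  have h2 : HasFDerivAt (dyArg r) (c • (-((2 : ℝ) • (innerSL ℝ (horizPart x)).comp horizPart))) x := by
    show HasFDerivAt (fun y : EuclideanSpace ℝ (Fin 3) => c * ((2 * r) ^ 2 - ‖horizPart y‖ ^ 2)) _ x
    exact (h1.const_sub ((2 * r) ^ 2)).const_mul c
  have hT : HasDerivAt (deriv Real.smoothTransition) (deriv (deriv Real.smoothTransition) (dyArg r x))
      (dyArg r x) :=
    (Wei2016.differentiable_deriv_smoothTransition _).hasDerivAt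
  have h3 := (hT.comp_hasFDerivAt x h2).mul_const (c * (-2))
  refine h3.congr_fderiv ?_
  ext v
  simp only [_root_.smul_apply, _root_.neg_apply, ContinuousLinearMap.comp_apply, innerSL_apply_apply,
    inner_horizPart_horizPart, smul_eq_mul, hc]
  ring

/-- **Bounds for the coefficient.** There is an absolute `C ≥ 0` such that for every `r > 0`,
with `χ = 𝟙{r ≤ ρ < 2r}`: `|a(x)| ≤ (C/r²) χ(x)` and `‖Da(x)‖ ≤ (C/r³) χ(x)` for all `x` (in
particular `a` and `Da` vanish off the annulus). -/
theorem exists_dyCoeff_bounds :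
    ∃ C : ℝ, 0 ≤ C ∧ ∀ r : ℝ, 0 < r →
      (∀ x, |dyCoeff r x| ≤
          C / r ^ 2 * {x | r ≤ cylRadius x ∧ cylRadius x < 2 * r}.indicator (fun _ => (1 : ℝ)) x) ∧
      ∀ x, ‖fderiv ℝ (dyCoeff r) x‖ ≤
          C / r ^ 3 * {x | r ≤ cylRadius x ∧ cylRadius x < 2 * r}.indicator (fun _ => (1 : ℝ)) x := by
  obtain ⟨C₁, hC₁0, hC₁⟩ := LeiZhang2011.exists_abs_deriv_smoothTransition_le
  obtain ⟨C₂, hC₂0, hC₂⟩ := Carleman.exists_bound_deriv_deriv_smoothTransition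
  refine ⟨C₁ + C₂, by positivity, fun r hr => ?_⟩
  set A : Set (EuclideanSpace ℝ (Fin 3)) := {x | r ≤ cylRadius x ∧ cylRadius x < 2 * r} with hA
  set χ : EuclideanSpace ℝ (Fin 3) → ℝ := A.indicator fun _ => (1 : ℝ) with hχ
  have hc : ((2 * r) ^ 2 - r ^ 2)⁻¹ = (3 * r ^ 2)⁻¹ := by ring_nf
  have hc0 : 0 < (3 * r ^ 2)⁻¹ := by positivity
  -- the argument off the annulus
  have harg_out : ∀ x, 2 * r ≤ cylRadius x → dyArg r x ≤ 0 := fun x hx => by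
    rw [dyArg, hc, norm_horizPart]
    have : (2 * r) ^ 2 - cylRadius x ^ 2 ≤ 0 := by nlinarith [cylRadius_nonneg x]
    exact mul_nonpos_of_nonneg_of_nonpos hc0.le this
  have harg_in : ∀ x, cylRadius x < r → 1 ≤ dyArg r x := fun x hx => by
    rw [dyArg, hc, norm_horizPart]
    have h0 := cylRadius_nonneg x
    rw [le_inv_mul_iff₀ (by positivity : (0 : ℝ) < 3 * r ^ 2), mul_one]
    nlinarith
  have hzero : ∀ x, x ∉ A → deriv Real.smoothTransition (dyArg r x) = 0 ∧
      deriv (deriv Real.smoothTransition) (dyArg r x) = 0 := by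
    intro x hx
    simp only [hA, mem_setOf_eq, not_and_or, not_le, not_lt] at hx
    rcases hx with hx | hx
    · exact ⟨Literature.Analysis.Calculus.deriv_smoothTransition_of_one_le (harg_in x hx),
        Wei2016.deriv_deriv_smoothTransition_of_one_le (harg_in x hx)⟩
    · exact ⟨Literature.Analysis.Calculus.deriv_smoothTransition_of_nonpos (harg_out x hx),
        Wei2016.deriv_deriv_smoothTransition_of_nonpos (harg_out x hx)⟩
  constructor
  · intro x
    by_cases hx : x ∈ A
    · have hχ1 : χ x = 1 := by simp [hχ, hx]
      rw [hχ1, mul_one, dyCoeff, hc, abs_mul]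
      calc |deriv Real.smoothTransition (dyArg r x)| * |(3 * r ^ 2)⁻¹ * -2|
          ≤ C₁ * ((3 * r ^ 2)⁻¹ * 2) := by
            rw [abs_mul, abs_of_pos hc0, abs_neg, abs_two]
            exact mul_le_mul_of_nonneg_right (hC₁ _) (by positivity)
        _ ≤ (C₁ + C₂) / r ^ 2 := by
            rw [div_eq_mul_inv]
            have : (3 * r ^ 2)⁻¹ * 2 ≤ (r ^ 2)⁻¹ := by
              rw [mul_inv, mul_assoc, mul_comm _ (2 : ℝ), ← mul_assoc]; norm_num
              exact mul_le_of_le_one_left (by positivity) (by norm_num)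
            calc C₁ * ((3 * r ^ 2)⁻¹ * 2) ≤ C₁ * (r ^ 2)⁻¹ := mul_le_mul_of_nonneg_left this hC₁0
              _ ≤ (C₁ + C₂) * (r ^ 2)⁻¹ := mul_le_mul_of_nonneg_right (by linarith) (by positivity)
    · have hχ0 : χ x = 0 := by simp [hχ, hx]
      rw [hχ0, mul_zero, dyCoeff, (hzero x hx).1, zero_mul, abs_zero]
  · intro x
    rw [(hasFDerivAt_dyCoeff r x).fderiv]
    by_cases hx : x ∈ A
    · have hχ1 : χ x = 1 := by simp [hχ, hx]
      have hρ : cylRadius x < 2 * r := hx.2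
      rw [hχ1, mul_one, norm_smul, innerSL_apply_norm, norm_horizPart, hc, Real.norm_eq_abs, abs_mul,
        show |(3 * r ^ 2)⁻¹ * -2 * ((3 * r ^ 2)⁻¹ * -2)| = 4 * ((3 * r ^ 2)⁻¹) ^ 2 by
          rw [show (3 * r ^ 2)⁻¹ * -2 * ((3 * r ^ 2)⁻¹ * -2) = 4 * ((3 * r ^ 2)⁻¹) ^ 2 by ring]
          exact abs_of_nonneg (by positivity)]
      calc |deriv (deriv Real.smoothTransition) (dyArg r x)| * (4 * ((3 * r ^ 2)⁻¹) ^ 2) * cylRadius x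
          ≤ C₂ * (4 * ((3 * r ^ 2)⁻¹) ^ 2) * (2 * r) :=
            mul_le_mul (mul_le_mul_of_nonneg_right (hC₂ _) (by positivity)) hρ.le
              (cylRadius_nonneg x) (by positivity)
        _ = (8 / 9 * C₂) / r ^ 3 := by field_simp; ring
        _ ≤ (C₁ + C₂) / r ^ 3 := by
            refine div_le_div_of_nonneg_right ?_ (by positivity)
            nlinarith
    · have hχ0 : χ x = 0 := by simp [hχ, hx]
      rw [hχ0, mul_zero, (hzero x hx).2, zero_mul, zero_smul, norm_zero]

/-! ### The rotation field `W = a • J x = J ∇φ` -/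

/-- **The rotation field of the dyadic cut-off**, `W(x) = a(x) J x = J ∇φ(x)` (horizontal,
tangent to circles about the axis, supported in the annulus `{r ≤ ρ < 2r}`). -/
def corrField (r : ℝ) (x : EuclideanSpace ℝ (Fin 3)) : EuclideanSpace ℝ (Fin 3) :=
  dyCoeff r x • rotGen x

/-- `W` is smooth. -/
theorem contDiff_corrField (r : ℝ) {n : ℕ∞} : ContDiff ℝ n (corrField r) :=
  (contDiff_dyCoeff r).smul rotGenL.contDiff

/-- `W` is invariant under axial translations. -/
theorem corrField_add_smul_eZ (r : ℝ) (x : EuclideanSpace ℝ (Fin 3)) (t : ℝ) :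
    corrField r (x + t • eZ) = corrField r x := by
  rw [corrField, corrField, dyCoeff_add_smul_eZ, rotGen_add_smul_eZ]

/-- `W` is axially periodic of every period. -/
theorem isAxiallyPeriodic_corrField (L r : ℝ) : IsAxiallyPeriodic L (corrField r) := fun x =>
  corrField_add_smul_eZ r x L

/-- The derivative of `W`: `DW(x) v = (Da(x) v) J x + a(x) J v`. -/
theorem hasFDerivAt_corrField (r : ℝ) (x : EuclideanSpace ℝ (Fin 3)) :
    HasFDerivAt (corrField r)
      ((fderiv ℝ (dyCoeff r) x).smulRight (rotGen x) + dyCoeff r x • rotGenL) x := by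
  have h1 : HasFDerivAt (dyCoeff r) (fderiv ℝ (dyCoeff r) x) x :=
    ((contDiff_dyCoeff r (n := 1)).differentiable one_ne_zero x).hasFDerivAt
  have h := h1.smul (hasFDerivAt_rotGen x)
  refine h.congr_fderiv ?_
  ext v
  simp [ContinuousLinearMap.smulRight_apply, add_comm]

/-- **Bounds for `W` and `DW`.** There is an absolute `C ≥ 0` such that for every `r > 0`, with
`χ = 𝟙{r ≤ ρ < 2r}`: `‖W(x)‖ ≤ (C/r) χ(x)` and `‖DW(x)‖ ≤ (C/r²) χ(x)` for all `x`; the same `C`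
bounds the coefficient, `|a(x)| ≤ (C/r²) χ(x)`. -/
theorem exists_corrField_bounds :
    ∃ C : ℝ, 0 ≤ C ∧ ∀ r : ℝ, 0 < r →
      (∀ x, |dyCoeff r x| ≤
          C / r ^ 2 * {x | r ≤ cylRadius x ∧ cylRadius x < 2 * r}.indicator (fun _ => (1 : ℝ)) x) ∧
      (∀ x, ‖corrField r x‖ ≤
          C / r * {x | r ≤ cylRadius x ∧ cylRadius x < 2 * r}.indicator (fun _ => (1 : ℝ)) x) ∧
      ∀ x, ‖fderiv ℝ (corrField r) x‖ ≤
          C / r ^ 2 * {x | r ≤ cylRadius x ∧ cylRadius x < 2 * r}.indicator (fun _ => (1 : ℝ)) x := by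
  obtain ⟨C, hC0, hC⟩ := exists_dyCoeff_bounds
  have hJn : ∀ y : EuclideanSpace ℝ (Fin 3), ‖rotGen y‖ = cylRadius y := fun y => by
    rw [cylRadius, ← Real.sqrt_sq (norm_nonneg (rotGen y)), EuclideanSpace.real_norm_sq_eq]
    congr 1
    simp only [Fin.sum_univ_three, rotGen_apply_zero, rotGen_apply_one, rotGen_apply_two, neg_sq]
    nlinarith [Real.norm_eq_abs (y 0), Real.norm_eq_abs (y 1), sq_abs (y 0), sq_abs (y 1),
      Real.norm_eq_abs (0:ℝ)]
  refine ⟨3 * C, by positivity, fun r hr => ⟨fun x => ?_, fun x => ?_, fun x => ?_⟩⟩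
  · refine ((hC r hr).1 x).trans (mul_le_mul_of_nonneg_right ?_ (Set.indicator_nonneg (fun _ _ => zero_le_one) x))
    exact div_le_div_of_nonneg_right (by linarith) (by positivity)
  · set χ := {x | r ≤ cylRadius x ∧ cylRadius x < 2 * r}.indicator (fun _ => (1 : ℝ)) with hχ
    by_cases hx : x ∈ {x | r ≤ cylRadius x ∧ cylRadius x < 2 * r}
    · have hχ1 : χ x = 1 := by simp [hχ, hx]
      have h1 := (hC r hr).1 x
      rw [← hχ] at h1; rw [hχ1, mul_one] at h1 ⊢
      rw [corrField, norm_smul, Real.norm_eq_abs, hJn]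
      calc |dyCoeff r x| * cylRadius x ≤ C / r ^ 2 * (2 * r) :=
            mul_le_mul h1 hx.2.le (cylRadius_nonneg x) (by positivity)
        _ = 2 * C / r := by field_simp
        _ ≤ 3 * C / r := div_le_div_of_nonneg_right (by linarith) hr.le
    · have hχ0 : χ x = 0 := by simp [hχ, hx]
      have h1 := (hC r hr).1 x
      rw [← hχ] at h1; rw [hχ0, mul_zero] at h1 ⊢
      have : dyCoeff r x = 0 := abs_eq_zero.1 (le_antisymm h1 (abs_nonneg _))
      rw [corrField, this, zero_smul, norm_zero]
  · set χ := {x | r ≤ cylRadius x ∧ cylRadius x < 2 * r}.indicator (fun _ => (1 : ℝ)) with hχ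
    rw [(hasFDerivAt_corrField r x).fderiv]
    have hrotL : ‖(rotGenL : EuclideanSpace ℝ (Fin 3) →L[ℝ] EuclideanSpace ℝ (Fin 3))‖ ≤ 1 := by
      refine ContinuousLinearMap.opNorm_le_bound _ zero_le_one fun v => ?_
      rw [one_mul, rotGenL_apply, hJn, ← norm_horizPart]
      have h1 : ‖horizPart v‖ ^ 2 ≤ ‖v‖ ^ 2 := by
        rw [norm_horizPart_sq, EuclideanSpace.real_norm_sq_eq]
        simp only [Fin.sum_univ_three]
        nlinarith [sq_nonneg (v 2), Real.norm_eq_abs (v 2), sq_abs (v 2)]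
      exact (pow_le_pow_iff_left₀ (norm_nonneg _) (norm_nonneg _) two_ne_zero).1 h1
    by_cases hx : x ∈ {x | r ≤ cylRadius x ∧ cylRadius x < 2 * r}
    · have hχ1 : χ x = 1 := by simp [hχ, hx]
      have h1 := (hC r hr).1 x
      have h2 := (hC r hr).2 x
      rw [← hχ] at h1 h2; rw [hχ1, mul_one] at h1 h2 ⊢
      have e1 : ‖(fderiv ℝ (dyCoeff r) x).smulRight (rotGen x)‖ ≤ C / r ^ 3 * (2 * r) := by
        rw [ContinuousLinearMap.norm_smulRight_apply, hJn]
        exact mul_le_mul h2 hx.2.le (cylRadius_nonneg x) (by positivity)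
      have e2 : ‖dyCoeff r x • (rotGenL : EuclideanSpace ℝ (Fin 3) →L[ℝ] EuclideanSpace ℝ (Fin 3))‖ ≤
          C / r ^ 2 * 1 := by
        rw [norm_smul, Real.norm_eq_abs]
        exact mul_le_mul h1 hrotL (norm_nonneg _) (by positivity)
      calc ‖(fderiv ℝ (dyCoeff r) x).smulRight (rotGen x) + dyCoeff r x • rotGenL‖
          ≤ C / r ^ 3 * (2 * r) + C / r ^ 2 * 1 := (norm_add_le _ _).trans (add_le_add e1 e2)
        _ = 3 * C / r ^ 2 := by field_simp; ring
    · have hχ0 : χ x = 0 := by simp [hχ, hx]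
      have h1 := (hC r hr).1 x
      have h2 := (hC r hr).2 x
      rw [← hχ] at h1 h2; rw [hχ0, mul_zero] at h1 h2 ⊢
      have ha : dyCoeff r x = 0 := abs_eq_zero.1 (le_antisymm h1 (abs_nonneg _))
      have hDa : fderiv ℝ (dyCoeff r) x = 0 := norm_eq_zero.1 (le_antisymm h2 (norm_nonneg _))
      have e : (fderiv ℝ (dyCoeff r) x).smulRight (rotGen x) + dyCoeff r x • rotGenL = 0 := by
        rw [ha, hDa]; ext v; simp
      rw [e, norm_zero]

/-- **`W` is divergence free**: `div (a J x) = a div J + ⟪J x, ∇a⟫ = 0` (`J` is trace free and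
`a` is axisymmetric). -/
theorem divergence_corrField (r : ℝ) (x : EuclideanSpace ℝ (Fin 3)) :
    VectorCalculus.divergence (corrField r) x = 0 := by
  have hdiff : DifferentiableAt ℝ (dyCoeff r) x := (contDiff_dyCoeff r (n := 1)).differentiable one_ne_zero x
  have h := divergence_smul_apply (u := rotGen) hdiff (hasFDerivAt_rotGen x).differentiableAt
  have hdivJ : VectorCalculus.divergence rotGen x = 0 := by
    set b := EuclideanSpace.basisFun (Fin 3) ℝ with hb
    rw [divergence_eq_sum_inner_fderiv b, (hasFDerivAt_rotGen x).fderiv, Fin.sum_univ_three]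
    have hb0 : b 0 = EuclideanSpace.single 0 (1 : ℝ) := by simp [hb]
    have hb1 : b 1 = EuclideanSpace.single 1 (1 : ℝ) := by simp [hb]
    have hb2 : b 2 = EuclideanSpace.single 2 (1 : ℝ) := by simp [hb]
    rw [hb0, hb1, hb2]
    simp only [rotGenL_apply, rotGen_single_zero, rotGen_single_one, rotGen_single_two, inner_neg_right,
      EuclideanSpace.inner_single_left, inner_zero_right]
    simp
  have hax : ⟪rotGen x, gradient (dyCoeff r) x⟫ = 0 :=
    (isAxisymmetricScalar_dyCoeff r).inner_rotGen_gradient hdiff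
  show VectorCalculus.divergence (fun y => dyCoeff r y • rotGen y) x = 0
  rw [h, hdivJ, hax, mul_zero, add_zero]

end Summit.NavierStokesRegularity.NavierStokesRegularity.Theorems.ScenarioCensus.PeriodicSlab

end
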